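import Summits.NavierStokesRegularity.FluidComputer.BlockQuadGate

/-!
# The block design — the QUADRATIC gate inhabits the open circuit+clock; the residue for the
degree-consistent gate (bp3 gen 34, ASSEMBLY §2g.9(j))

HONEST FRAMING: low prior, high value-of-information experiment on Tao's machine paradigm; NOT a
claim that NS blows up. Design level only: nothing in this file is a statement about
Navier–Stokes.

`BlockQuadGate` constructed the conservative quadratic exchange gate `quadGate k η` (the flow of
`(a, b) ↦ (−k η a b, k a²)`, energy `a² + η b²` conserved exactly) — the degree-consistent
replacement for the LINEAR quarter turn `regGate` demanded by the no-go of `BlockDegreeNoGo`.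
This file puts it into the architecture of `BlockOpenWindow` with NO other change:

* `quadGate_datO` — for `Params.reg` (`aLo = 3/2`, `δ = 1/20`, `c0 = 3/20`, `σsp = 1/4`), every
  coupling `k ≥ 6` and every `η ∈ [1/2, 9/10]`, firing at rescaled time `σ = 1` from every open
  admissible input lands, with margin `δsh = 1/50`, in the open output window: input amplitude
  spent to `|a'| ≤ 0.23 + 0.02`, output amplitude `b' ≥ 1.52 − 0.02`. (Elementary: with
  `x = k √η R ≥ 6.09` one has `E = eˣ ≥ x⁴/24 ≥ 57` and `E ≥ 9x ≥ 37 a`; then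
  `a' = 2aE/D ≤ 30a/(13E)` and `1 − √η b'/R = 2(1−s)/D ≤ (34/13) E⁻²`.) The transfer time is
  `≍ 1/(k √η R)`: SHORTER at larger input amplitude — the signature of a quadratic gate, and the
  reason the OPEN input window (no upper amplitude bound) costs nothing here.
* `quadGate_passiveO` — `0`-passive (indeed conservative) on the open input window.
* `openQuadCircuitClock` — the CIRCUIT+CLOCK half `OpenCircuitClock (Params.reg …)` inhabited by
  the quadratic gate: `τc = 1`, `δsh = 1/50`, clock `unit n = Tmax n`.
* `ns_blowup_of_openQuadIdeaBound` — the residue in closed form: the single `Prop`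
  `OpenIdeaBound 𝒟 (Params.reg …) (openQuadCircuitClock …)` (shadowing + leakage of true
  Navier–Stokes trajectories relative to the QUADRATIC circuit for one tick) refutes Clay (A), for
  every `k ≥ 6`, `η ∈ [1/2, 9/10]`, `α > 0`; `openQuad_hypotheses_inhabited` — everything but
  `OpenIdeaBound` is jointly satisfiable.

HONEST READING (the ledger this lane owes). What moved: the circuit's local form is now one the
degree/sign dictionary of `BlockDegreeNoGo` ALLOWS (`quadQF_signSymm`, `quadQF_conserves`,
`QuadField.eval_eq_of_conserves`), so the structural reason (§2g.9(i)) for which the LINEAR residue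
`OpenIdeaBound … (openRegCircuitClock …)` is presumably false does not apply to the quadratic one.
What did NOT move: `OpenIdeaBound … (openQuadCircuitClock …)` is STILL presumably FALSE for the bare
two-wavelet design and is asserted nowhere — (α) the design's two-mode Galerkin form is
`(k₁ a + k₂ b)(−η b, a)` with `(k₁, k₂)` fixed by the wavelet pair, and `k₂ = 0`, `k₁ ≥ 6` (in the
lane's normalisation, which also fixes the clock `unit n = Tmax n`) are CONDITIONS on the pair this
lane has not verified for any concrete pair; (β) LEAKAGE: the components of `B(u,u)` outside the
pair are generically of the same order as `k₁`, against a tolerated shadowing error of `1/50` per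
tick — suppressing them is the substance of Tao's averaged-equation construction and is exactly
what true NS does not offer; (γ) viscosity (diagonal damping) only delays transfer. IDEA-BOUND, not
physically plausible; value = a sharper statement of WHICH idea is bound. Nothing here is evidence
about Navier–Stokes in either direction.
-/

noncomputable section

open Set Filter Topology

namespace Summit.NavierStokesRegularity.FluidComputer

open Literature.Analysis.FluidPDE Literature.Analysis.FluidPDE.Tao2016
open Literature.Analysis.FluidPDE.FluidComputer
open Summit.NavierStokesRegularity.NavierStokesRegularity.Theorems.FluidComputer

namespace BlockDesign

/-! ## Two exponential bounds -/

section Numerics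

/-- `exp x ≥ 57` for `x ≥ 6.09` (from `x⁴/24 ≤ exp x`). [folklore] -/
theorem exp_ge_of_ge_609 {x : ℝ} (hx : 609 / 100 ≤ x) : 57 ≤ Real.exp x := by
  have h4 := Real.pow_div_factorial_le_exp x (show (0 : ℝ) ≤ x by linarith) 4
  have hp : ((609 : ℝ) / 100) ^ 4 ≤ x ^ 4 := pow_le_pow_left₀ (by norm_num) hx 4
  norm_num [Nat.factorial] at h4 hp ⊢
  linarith

/-- `exp x ≥ 9 x` for `x ≥ 6.09` (from `x⁴/24 ≤ exp x` and `x³ ≥ 225`). [folklore] -/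
theorem exp_ge_nine_mul_of_ge_609 {x : ℝ} (hx : 609 / 100 ≤ x) : 9 * x ≤ Real.exp x := by
  have h4 := Real.pow_div_factorial_le_exp x (show (0 : ℝ) ≤ x by linarith) 4
  have hp : ((609 : ℝ) / 100) ^ 3 ≤ x ^ 3 := pow_le_pow_left₀ (by norm_num) hx 3
  norm_num [Nat.factorial] at h4 hp ⊢
  nlinarith [mul_le_mul_of_nonneg_right hp (by linarith : (0 : ℝ) ≤ x)]

end Numerics

/-! ## The quadratic gate inhabits the open `dat` for `Params.reg` -/

section Reg

variable (S : CascadeSpecs)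

/-- **The quadratic gate inhabits the open `dat`**: for `Params.reg`, every coupling `k ≥ 6` and
every `η ∈ [1/2, 9/10]`, firing at `σ = 1` from every `p ∈ AinO` (`a > 1.45`, `|b| < 0.2`, ANY
larger `a`) gives `0 ≤ a' ≤ 0.23` and `b' ≥ 1.52`, so the closed `1/50`-ball around the fired
state lies in `AoutO` (`|a'| ≤ 1/4`, `b' ≥ 3/2`). [folklore] -/
theorem quadGate_datO (hS : S.lam0 = 1) (hη : 1 / 2 ≤ S.eta) (hη2 : S.eta ≤ 9 / 10) {k : ℝ}
    (hk : 6 ≤ k) : DatO (Params.reg S hS hη) (quadGate k S.eta) 1 (1 / 50) := by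
  intro p hp
  obtain ⟨ha, hb⟩ := AinO_bounds hp
  change (3 : ℝ) / 2 - 1 / 20 < p.1 at ha
  change |p.2| < (3 : ℝ) / 20 + 1 / 20 at hb
  refine ⟨1, zero_le_one, le_rfl, ?_⟩
  intro q hq
  -- the constants of the closed form at `σ = 1`
  have ht1 : Real.sqrt S.eta ≤ 19 / 20 := by
    rw [Real.sqrt_le_left (by norm_num)]
    linarith
  have ht0 : 7 / 10 < Real.sqrt S.eta := by
    rw [Real.lt_sqrt (by norm_num)]
    linarith
  have hRa : p.1 ≤ qRad S.eta p := le_trans (le_abs_self _) (abs_le_qRad S.eta_pos.le p)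
  have hR0 : qRad S.eta p ≠ 0 := by
    intro h
    linarith
  have hsR : qFrac S.eta p * qRad S.eta p = Real.sqrt S.eta * p.2 := div_mul_cancel₀ _ hR0
  rw [Metric.mem_closedBall, Prod.dist_eq, Real.dist_eq, Real.dist_eq] at hq
  simp only [quadGate, mul_one] at hq
  set t := Real.sqrt S.eta
  set R := qRad S.eta p
  set s := qFrac S.eta p
  set E := Real.exp (k * t * R)
  have hq1 := le_trans (le_max_left _ _) hq
  have hq2 := le_trans (le_max_right _ _) hq
  have ht : 0 < t := by linarith
  have hR : (29 : ℝ) / 20 < R := by linarith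
  have hRpos : 0 < R := by linarith
  have hap : 0 < p.1 := by linarith
  -- the loaded fraction is small: `|s| ≤ 2/15`
  have hsabs : |s| * R ≤ 19 / 100 := by
    rw [← abs_of_pos hRpos, ← abs_mul, hsR, abs_mul, abs_of_pos ht]
    have := mul_le_mul ht1 hb.le (abs_nonneg _) (by norm_num : (0 : ℝ) ≤ 19 / 20)
    linarith
  have hs : |s| ≤ 2 / 15 := by
    by_contra hc
    push Not at hc
    nlinarith [mul_pos (sub_pos.2 hc) (sub_pos.2 hR)]
  have hs1 : |s| ≤ 1 := by linarith
  obtain ⟨hsl, hsu⟩ := abs_le.1 hs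
  -- the exponent is large: `x = k t R ≥ 6.09`, `x ≥ 4.2 a`
  have hk0 : 0 ≤ k := by linarith
  have hkt : 6 * (7 / 10) ≤ k * t := mul_le_mul hk ht0.le (by norm_num) hk0
  have hx : (609 : ℝ) / 100 ≤ k * t * R := by
    have := mul_le_mul hkt hR.le (by norm_num) (by positivity)
    linarith
  have hxa : (21 : ℝ) / 5 * p.1 ≤ k * t * R := by
    have := mul_le_mul hkt hRa hap.le (by positivity)
    linarith
  have hE57 : (57 : ℝ) ≤ E := exp_ge_of_ge_609 hx
  have hEa : 37 * p.1 ≤ E := by linarith [exp_ge_nine_mul_of_ge_609 hx]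
  have hEpos : 0 < E := Real.exp_pos _
  have hD : 0 < (1 + s) * (E * E) + (1 - s) := qDen_pos hs1 hEpos
  have hDlo : (13 : ℝ) / 15 * (E * E) ≤ (1 + s) * (E * E) + (1 - s) := by
    nlinarith [mul_nonneg (by linarith : (0 : ℝ) ≤ s + 2 / 15) (mul_pos hEpos hEpos).le]
  -- first component: `0 ≤ a' ≤ 0.23`
  have ha'0 : 0 ≤ 2 * p.1 * E / ((1 + s) * (E * E) + (1 - s)) := by positivity
  have ha'1 : 2 * p.1 * E / ((1 + s) * (E * E) + (1 - s)) ≤ 23 / 100 := by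
    rw [div_le_iff₀ hD]
    nlinarith [mul_le_mul_of_nonneg_left hEa hEpos.le, mul_pos hap hEpos]
  -- second component: `b' ≥ 1.52`, i.e. `(1+s) E² (R − 1.52 t) ≥ (1−s)(R + 1.52 t)`
  have hY : 0 < R - 76 / 50 * t := by linarith
  have hEE : (57 : ℝ) * 57 ≤ E * E := mul_le_mul hE57 hE57 (by norm_num) hEpos.le
  have h3 : (13 : ℝ) / 15 * (57 * 57) * (R - 76 / 50 * t) ≤
      (1 + s) * (E * E) * (R - 76 / 50 * t) :=
    mul_le_mul_of_nonneg_right (mul_le_mul (by linarith) hEE (by norm_num) (by linarith)) hY.le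
  have h4 : (1 - s) * (R + 76 / 50 * t) ≤ 17 / 15 * (R + 76 / 50 * t) :=
    mul_le_mul_of_nonneg_right (by linarith) (by linarith)
  have hb' : (76 : ℝ) / 50 ≤
      R * ((1 + s) * (E * E) - (1 - s)) / (t * ((1 + s) * (E * E) + (1 - s))) := by
    rw [le_div_iff₀ (mul_pos ht hD)]
    linarith
  -- the ball of radius `1/50` around the fired state lies in `AoutO`
  have h1 := abs_le.1 hq1
  have h2 := abs_le.1 hq2
  simp only [AoutO, Params.reg, Set.mem_prod, Set.mem_Icc, Set.mem_Ici]
  exact ⟨⟨by linarith, by linarith⟩, by linarith⟩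

/-- The quadratic gate is `0`-passive on the open input window (indeed conservative, at all times,
from all states: `pairEnergy_quadGate`). [folklore] -/
theorem quadGate_passiveO (P : Params S) (k τc : ℝ) : PassiveO P (quadGate k S.eta) τc 0 := by
  intro p _ σ _ _
  rw [pairEnergy_quadGate S.eta_pos, add_zero]

/-- **The open CIRCUIT+CLOCK half inhabited by the QUADRATIC gate** for `Params.reg`, every
`k ≥ 6`, `η ∈ [1/2, 9/10]`: `Φ = quadGate k η`, `τc = 1`, `δsh = 1/50`, clock `unit n = Tmax n`.
[folklore] -/
def openQuadCircuitClock (hS : S.lam0 = 1) (hη : 1 / 2 ≤ S.eta) (hη2 : S.eta ≤ 9 / 10) {k : ℝ}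
    (hk : 6 ≤ k) : OpenCircuitClock (Params.reg S hS hη) where
  Φ := quadGate k S.eta
  τc := 1
  τc_nonneg := zero_le_one
  δsh := 1 / 50
  δsh_nonneg := by norm_num
  dat := quadGate_datO S hS hη hη2 hk
  unit n := S.Tmax n
  unit_pos n := S.Tmax_pos n
  clock n := (mul_one _).le

/-- The quadratic open circuit conserves the two-block energy at all rescaled times and is
`0`-passive. [folklore] -/
theorem openQuadCircuitClock_conservative (hS : S.lam0 = 1) (hη : 1 / 2 ≤ S.eta)
    (hη2 : S.eta ≤ 9 / 10) {k : ℝ} (hk : 6 ≤ k) :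
    (∀ p : ℝ × ℝ, ∀ σ : ℝ,
        pairEnergy S.eta ((openQuadCircuitClock S hS hη hη2 hk).Φ σ p) = pairEnergy S.eta p) ∧
      PassiveO (Params.reg S hS hη) (openQuadCircuitClock S hS hη hη2 hk).Φ
        (openQuadCircuitClock S hS hη hη2 hk).τc 0 :=
  ⟨fun p σ => pairEnergy_quadGate S.eta_pos k σ p, quadGate_passiveO S _ k _⟩

variable {S}

/-- **The residue for the degree-consistent gate, in closed form.** For `Params.reg` with open
windows, `η ∈ [1/2, 9/10]`, `α > 0`, any coupling `k ≥ 6`: the two IDEA-BOUND claims about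
Navier–Stokes relative to the explicit conservative QUADRATIC circuit refute Clay (A). HONEST
FRAMING: an implication from a `Prop` this lane presumes FALSE for the two-wavelet design (module
docstring, (α)–(γ)); NOT a claim that NS blows up. -/
theorem ns_blowup_of_openQuadIdeaBound {𝒟 : CascadeWaveletData 1 1} (hS : S.lam0 = 1)
    (hη : 1 / 2 ≤ S.eta) (hη2 : S.eta ≤ 9 / 10) {k : ℝ} (hk : 6 ≤ k) (hα : 0 < S.alpha)
    (H : OpenIdeaBound 𝒟 (Params.reg S hS hη) (openQuadCircuitClock S hS hη hη2 hk)) :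
    ¬ NavierStokesRegularity :=
  ns_blowup_of_openIdeaBound _ H hα (by linarith)

/-- The hypotheses other than `OpenIdeaBound` are jointly satisfiable (a wavelet datum, an
admissible spec with `λ₀ = 1`, `α > 0`, `η ∈ [1/2, 9/10]`, and a coupling `k ≥ 6`). [folklore] -/
theorem openQuad_hypotheses_inhabited :
    ∃ (_ : CascadeWaveletData 1 1) (S : CascadeSpecs) (k : ℝ),
      S.lam0 = 1 ∧ 0 < S.alpha ∧ 1 / 2 ≤ S.eta ∧ S.eta ≤ 9 / 10 ∧ 6 ≤ k := by
  obtain ⟨𝒟⟩ := nonempty_design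
  exact ⟨𝒟, ⟨1, 1, 1, 1, 1 / 2, one_pos, one_pos, one_pos, by norm_num, by norm_num⟩, 6, rfl,
    one_pos, by norm_num, by norm_num, le_rfl⟩

end Reg

end BlockDesign

end Summit.NavierStokesRegularity.FluidComputer
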